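import Summits.QuantumFields.YangMills.Theorems.VirialFluxGapFixFrame
import Summits.QuantumFields.YangMills.Theorems.VirialFluxGapBlockZeroModeField
import Summits.QuantumFields.YangMills.Theorems.VirialFluxGapCentralConeEuler
import HarnessLib

/-!
# Route `VirialFluxGap` (YangMills): the CENTRAL ZERO-MODE FIELD IN THE `X_fix` FRAME LETTERS — its coordinate vector `u_z(P)` in w2's
# frame family `fixFrame`, the direction `dirOf fixFrame u_z(P)`, and (E1) on the central family in those letters

Brick (C1) of the central charts for ⟨stmt-QuantumFields-24141⟩, gluing w3's blocks to the cell's common letters (✓`VirialFluxGapFixFrame`: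
`ι = FixVar L × Fin 3`, `τ = fixFrame`, `dirOf`).  The zero-mode half `X_z` of the central-chart field (LEAD design note №4, host `X_fix` by the
ruling of 2026-08-30T23:30Z) has, at the point `P`, the frame coordinates

  `u_z(P)(v,a) = bsliceCoeff (σ k) (wrapBlock k) k a P` if `fixVar v` is a wrap link of direction `k` (any slice), `zseamCoeff σ₄ a P` on a seam
  site, `0` on every other link (✓`VirialFluxGapBlockZeroModeField`, ✓`CentralZeroModeField`):

* `zeroModeCoeffAt` ∕ `zeroModeCoord` (plumbing defs, no `Prop`) and ★ `dirOf_fixFrame_zeroModeCoord` — for EVERY ring variable `w`,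
  `dirOf fixFrame (u_z P) w = Σ_a (coefficient at w)·E_a` (tree links of slice `0` carry `0` on both sides: wrap links are off the tree);
* ★★ `dirOf_fixFrame_zeroModeCoord_combConst` — on a comb-constant history `(combFlat h, q)` this direction IS the wrap-layer radial assignment of
  ✓`CombConstantRadialFlow` with `c = ½σ` (`quatMatrix(½σ_k·Im A_k)` on the wrap links of direction `k`, `0` elsewhere, `quatMatrix(½σ₄·Im B)` on
  the seam);
* ★★★ `cone_euler_fixFrame` — hence (E1) on the central family in the cell's letters:
  `2(1 − ε)·F₀(combFlat h, q) ≤ frameD (dirOf fixFrame (u_z(combFlat h, q))) ringPoly (ringCoord (combFlat h, q))` whenever every block is in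
  the hemisphere of its sign with `σ_B·Re q_B ≥ 1 − ε` (✓`cone_euler_ge`).

HONEST FRAMING: letters + the family inequality; the transverse half `A⁻¹(∇F₀ − ∇F₀∘π_C)`, (E2) off the family and the patching are NOT here;
⟨24141⟩ stays OPEN; the Yang–Mills mass gap is NOT proved; no summit is proved by a line.  Two plumbing `def`s, theorems otherwise; 0 `sorry`,
standard axioms.  Width seat `ym-line-sfw-p2-w3` g58 (cell ym-idea-1, free hands), `--supports stmt-QuantumFields-24141`.
References: [cite: CosteEtAl1985]; [cite: Luscher1983, §2]; [cite: SeilerLNP1982, §2].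
-/

set_option autoImplicit false

noncomputable section

open scoped Matrix Quaternion BigOperators
open Literature.MathematicalPhysics.QuantumFieldTheory hiding SU2
open Literature.MathematicalPhysics.QuantumLattice

namespace Summit.QuantumFields.YangMills.Theorems.VirialFluxGap.FrameDerivative

open Summit.QuantumFields.YangMills.Theorems.FemtoTransferGap
open Summit.QuantumFields.YangMills.Theorems.FemtoTransferGap.TT
open Summit.QuantumFields.YangMills.Theorems.FemtoTransferGap.TwoLattice.Flat (combFlat combFlat_apply)
open Summit.QuantumFields.YangMills.Theorems.VirialFluxGap.RingDeficit
open Summit.QuantumFields.YangMills.Theorems.VirialFluxGap.FrameHessian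
open Summit.QuantumFields.YangMills.Theorems.VirialFluxGap.FixFrame

variable {L : ℕ} [NeZero L]

/-! ## §1 The zero-mode coordinate vector -/

/-- The zero-mode coefficient at a ring variable, in the frame direction `a`: the signed wrap-block average on a wrap link of direction `k`,
the signed seam average on a seam site, `0` on every other link. [cite: CosteEtAl1985] -/
def zeroModeCoeffAt (L : ℕ) [NeZero L] (σ : Fin 3 → ℝ) (σ₄ : ℝ) (P : (Fin (2 * L - 1 + 1) → GaugeConfig 3 L SU2) × (Site 3 L → SU2)) :
    ((Fin (2 * L - 1 + 1) × Edge 3 L) ⊕ Site 3 L) → Fin 3 → ℝ :=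
  Sum.elim (fun ie a => if ie.2.1 ie.2.2 = -1 then bsliceCoeff L (σ ie.2.2) (wrapBlock L ie.2.2) ie.2.2 a P else 0)
    (fun _ a => zseamCoeff L σ₄ a P)

/-- ★ The zero-mode COORDINATE VECTOR `u_z(P) : FixVar L × Fin 3 → ℝ` in the frame family `fixFrame` of `X_fix`. [cite: CosteEtAl1985] -/
def zeroModeCoord (L : ℕ) [NeZero L] (σ : Fin 3 → ℝ) (σ₄ : ℝ) (P : (Fin (2 * L - 1 + 1) → GaugeConfig 3 L SU2) × (Site 3 L → SU2)) :
    FixVar L × Fin 3 → ℝ :=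
  fun va => zeroModeCoeffAt L σ σ₄ P (fixVar va.1) va.2

/-- ★ **The zero-mode direction at every ring variable**: `dirOf fixFrame (u_z P) w = Σ_a (coefficient at w)·E_a` — on the `X_fix` variables by
✓`dirOf_fixFrame_fixVar`, on the tree links of slice `0` both sides vanish (a tree link is never a wrap link, ✓`not_treeEdge_of_wrap`). [folklore] -/
theorem dirOf_fixFrame_zeroModeCoord (σ : Fin 3 → ℝ) (σ₄ : ℝ) (P : (Fin (2 * L - 1 + 1) → GaugeConfig 3 L SU2) × (Site 3 L → SU2))
    (w : (Fin (2 * L - 1 + 1) × Edge 3 L) ⊕ Site 3 L) :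
    dirOf (fixFrame (L := L)) (zeroModeCoord L σ σ₄ P) w = ∑ a, zeroModeCoeffAt L σ σ₄ P w a • quatMatrix (zUnit a) := by
  rcases exists_fixVar_or_tree w with ⟨v, rfl⟩ | ⟨e, he, rfl⟩
  · rw [dirOf_fixFrame_fixVar]
    rfl
  · rw [dirOf_fixFrame_tree _ he]
    have hne : ¬ e.1 e.2 = -1 := fun h => not_treeEdge_of_wrap h he
    simp [zeroModeCoeffAt, hne]

/-! ## §2 On the central family the direction is the radial assignment -/

/-- The seam coefficient on a history with constant seam `q` is the common value `½σ₄·Im_a(su2Quat q)`. [cite: CosteEtAl1985] -/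
theorem zseamCoeff_of_const_seam (σ₄ : ℝ) (a : Fin 3) (U : Fin (2 * L - 1 + 1) → GaugeConfig 3 L SU2) (q : SU2) :
    zseamCoeff L σ₄ a ((U, fun _ : Site 3 L => q) : (Fin (2 * L - 1 + 1) → GaugeConfig 3 L SU2) × (Site 3 L → SU2)) =
      (1 / 2 : ℝ) * σ₄ * (![(su2Quat q).imI, (su2Quat q).imJ, (su2Quat q).imK] : Fin 3 → ℝ) a := by
  unfold zseamCoeff
  have hL : (0 : ℝ) < (L : ℝ) := by exact_mod_cast NeZero.pos L
  have hN : ((L : ℝ) ^ 3) ≠ 0 := by positivity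
  have hsite : (Fintype.card (Site 3 L) : ℝ) = (L : ℝ) ^ 3 := by
    rw [TwoLattice.Electric.card_site]; push_cast; ring
  simp only [Finset.sum_const, Finset.card_univ, nsmul_eq_mul]
  rw [hsite]
  field_simp

omit [NeZero L] in
/-- `Σ_a (c·Im_a q)·E_a = quatMatrix (c • Im q)`. [folklore] -/
theorem sum_mul_im_smul_quatMatrix_zUnit (c : ℝ) (q : ℍ) :
    ∑ a, (c * (![q.imI, q.imJ, q.imK] : Fin 3 → ℝ) a) • quatMatrix (zUnit a) = quatMatrix (c • q.im) := by
  rw [sum_smul_quatMatrix_zUnit]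
  congr 1
  ext <;> simp

/-- ★★ **On a comb-constant history the zero-mode direction is the wrap-layer radial assignment with `c = ½σ`.** [cite: CosteEtAl1985] -/
theorem dirOf_fixFrame_zeroModeCoord_combConst (σ : Fin 3 → ℝ) (σ₄ : ℝ) (h : Fin 3 → SU2) (q : SU2)
    (w : (Fin (2 * L - 1 + 1) × Edge 3 L) ⊕ Site 3 L) :
    dirOf (fixFrame (L := L)) (zeroModeCoord L σ σ₄ ((fun _ : Fin (2 * L - 1 + 1) => combFlat (L := L) h, fun _ : Site 3 L => q) :
        (Fin (2 * L - 1 + 1) → GaugeConfig 3 L SU2) × (Site 3 L → SU2))) w =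
      Sum.elim (fun ie : Fin (2 * L - 1 + 1) × Edge 3 L =>
          if ie.2.1 ie.2.2 = -1 then quatMatrix (((1 / 2 : ℝ) * σ ie.2.2) • (su2Quat (h ie.2.2)).im) else 0)
        (fun _ => quatMatrix (((1 / 2 : ℝ) * σ₄) • (su2Quat q).im)) w := by
  rw [dirOf_fixFrame_zeroModeCoord]
  rcases w with ie | x
  · simp only [zeroModeCoeffAt, Sum.elim_inl]
    by_cases hw : ie.2.1 ie.2.2 = -1
    · simp only [if_pos hw, bsliceCoeff_wrapBlock_combConst]
      exact sum_mul_im_smul_quatMatrix_zUnit _ _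
    · simp [if_neg hw]
  · simp only [zeroModeCoeffAt, Sum.elim_inr, zseamCoeff_of_const_seam]
    exact sum_mul_im_smul_quatMatrix_zUnit _ _

/-! ## §3 (E1) on the central family, in the cell's letters -/

/-- ★★★ **(E1) on the central comb-constant family in the `X_fix` frame letters**: if every block is in the hemisphere of its sign with radial
factor `σ_B·Re q_B ≥ 1 − ε`, then `2(1 − ε)·F₀ ≤ ∂_{Y} F₀` for `Y = dirOf fixFrame (u_z P)` at `P = (combFlat h, q)`. [cite: CosteEtAl1985] -/
theorem cone_euler_fixFrame (h : Fin 3 → SU2) (q : SU2) (σ : Fin 3 → ℝ) (σ₄ ε : ℝ)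
    (hre : ∀ k, 1 - ε ≤ σ k * (su2Quat (h k)).re) (hre₄ : 1 - ε ≤ σ₄ * (su2Quat q).re) :
    2 * (1 - ε) * ringDeficit L (fun _ => false)
        ((fun _ : Fin (2 * L - 1 + 1) => combFlat (L := L) h, fun _ : Site 3 L => q) :
          (Fin (2 * L - 1 + 1) → GaugeConfig 3 L SU2) × (Site 3 L → SU2)) ≤
      frameD (dirOf (fixFrame (L := L)) (zeroModeCoord L σ σ₄
          ((fun _ : Fin (2 * L - 1 + 1) => combFlat (L := L) h, fun _ : Site 3 L => q) :
            (Fin (2 * L - 1 + 1) → GaugeConfig 3 L SU2) × (Site 3 L → SU2)))) (ringPoly L)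
        (ringCoord L (((fun _ : Fin (2 * L - 1 + 1) => combFlat (L := L) h, fun _ : Site 3 L => q) :
          (Fin (2 * L - 1 + 1) → GaugeConfig 3 L SU2) × (Site 3 L → SU2)))) := by
  have hdir : dirOf (fixFrame (L := L)) (zeroModeCoord L σ σ₄
      ((fun _ : Fin (2 * L - 1 + 1) => combFlat (L := L) h, fun _ : Site 3 L => q) :
        (Fin (2 * L - 1 + 1) → GaugeConfig 3 L SU2) × (Site 3 L → SU2))) =
      Sum.elim (fun ie : Fin (2 * L - 1 + 1) × Edge 3 L =>
          if ie.2.1 ie.2.2 = -1 then quatMatrix (((1 / 2 : ℝ) * σ ie.2.2) • (su2Quat (h ie.2.2)).im) else 0)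
        (fun _ => quatMatrix (((1 / 2 : ℝ) * σ₄) • (su2Quat q).im)) :=
    funext fun w => dirOf_fixFrame_zeroModeCoord_combConst σ σ₄ h q w
  rw [hdir]
  exact cone_euler_ge h q σ σ₄ ε hre hre₄

/-- ★★ The hemisphere form of `cone_euler_fixFrame` (`σ ∈ {±1}`, `σ·Re ≥ 0`, `|Im|² ≤ ε` blockwise). [cite: CosteEtAl1985] -/
theorem cone_euler_fixFrame_of_im (h : Fin 3 → SU2) (q : SU2) (σ : Fin 3 → ℝ) (σ₄ ε : ℝ)
    (hσ : ∀ k, σ k = 1 ∨ σ k = -1) (hσ₄ : σ₄ = 1 ∨ σ₄ = -1)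
    (hhem : ∀ k, 0 ≤ σ k * (su2Quat (h k)).re) (hhem₄ : 0 ≤ σ₄ * (su2Quat q).re)
    (him : ∀ k, (su2Quat (h k)).imI ^ 2 + (su2Quat (h k)).imJ ^ 2 + (su2Quat (h k)).imK ^ 2 ≤ ε)
    (him₄ : (su2Quat q).imI ^ 2 + (su2Quat q).imJ ^ 2 + (su2Quat q).imK ^ 2 ≤ ε) :
    2 * (1 - ε) * ringDeficit L (fun _ => false)
        ((fun _ : Fin (2 * L - 1 + 1) => combFlat (L := L) h, fun _ : Site 3 L => q) :
          (Fin (2 * L - 1 + 1) → GaugeConfig 3 L SU2) × (Site 3 L → SU2)) ≤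
      frameD (dirOf (fixFrame (L := L)) (zeroModeCoord L σ σ₄
          ((fun _ : Fin (2 * L - 1 + 1) => combFlat (L := L) h, fun _ : Site 3 L => q) :
            (Fin (2 * L - 1 + 1) → GaugeConfig 3 L SU2) × (Site 3 L → SU2)))) (ringPoly L)
        (ringCoord L (((fun _ : Fin (2 * L - 1 + 1) => combFlat (L := L) h, fun _ : Site 3 L => q) :
          (Fin (2 * L - 1 + 1) → GaugeConfig 3 L SU2) × (Site 3 L → SU2)))) :=
  cone_euler_fixFrame h q σ σ₄ ε (fun k => sign_mul_re_ge (hσ k) (h k) (hhem k) (him k)) (sign_mul_re_ge hσ₄ q hhem₄ him₄)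

end Summit.QuantumFields.YangMills.Theorems.VirialFluxGap.FrameDerivative

end
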